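import Mathlib
import HarnessLib
import Summits.NavierStokesRegularity.NavierStokesRegularity.Theorems.UnthreadedDoorAntidynamoWallMildMovingCentre
import Summits.NavierStokesRegularity.NavierStokesRegularity.Theorems.ThreadingFluxHorizonTowerZonalFrame

/-!
# Route `UnthreadedDoor` / `ThreadingFlux`, crux `PoloidalLiouville` (stmt-NavierStokesRegularity-1222), antidynamo v2 skeleton (sha16 `4ebf5683127b`),
# WALL `stub_scalarLiouville`: THE GALILEAN FRAME PATH OF A NON-TRIVIAL FLOW IS REAL-ANALYTIC — (ML) may assume an ANALYTIC moving centre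

Support file (seat leafhand-ns-unthreadeddoor-2 g2, cell decomp-ns), `--supports stmt-NavierStokesRegularity-1222 --as helper`; theorems only.

The reduction of the wall to print's vocabulary (`…WallMildMovingCentre`, p819292) produced a mild representative `w` whose vorticity is tangent to the
spheres about the centre `p(t) = x₀ − A(t)`, with the frame path `A` of the Oseen gauge only known to be CONTINUOUS.  Here:

* `exists_vorticity_triple` — at every instant a non-trivial flow of the wall's class has three vorticity values spanning `ℝ³` (non-zero triple product):
  otherwise all vorticity values at that instant lie in a plane — a FLAT DIRECTION at one instant, excluded by the one-instant Z (`curl_eq_zero_of_flat_direction_slice`).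
* ★★★ `curl_eq_zero_or_exists_analytic_gauge` — EITHER `curl v ≡ 0`, OR the Oseen gauge `v(t) = w(t, · − A(t)) + c(t)` has a frame path `A` that is
  REAL-ANALYTIC at every `t < 0`.  [The centre `p(t)` is the UNIQUE solution of the linear system `⟪p, ω_w(t,yᵢ)⟫ = ⟪yᵢ, ω_w(t,yᵢ)⟫` for a spanning
  vorticity triple; by the reciprocal-basis identity `⟪a, b × c⟫ p = ⟪p,a⟫ b × c + ⟪p,b⟫ c × a + ⟪p,c⟫ a × b` it is an explicit rational expression in the
  real-analytic functions `t ↦ ω_w(t, yᵢ)` near every instant.]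
* ★★ `stubScalarLiouville_of_mild_analyticCentre` / `poloidalLiouville_of_mild_analyticCentre` — hence the wall and the crux FOLLOW from (ML-a): «bounded
  ancient MILD solutions (continuous, uniformly bounded, weakly divergence-free, Oseen identity, jointly analytic, smooth slices) whose vorticity is tangent
  to the spheres about a REAL-ANALYTIC moving centre `p(t)` are irrotational».

HONEST LABEL: structure theorems and a by-name reduction; (ML-a) is OPEN in print; nothing here proves `stub_scalarLiouville`, `PoloidalLiouville` (1222), or
bears on Navier–Stokes regularity; no summit statement is proved. [folklore] [cite: KochNadirashviliSereginSverak2009, §1 p. 3, §4 (i)–(ii), Thm 5.2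
(arXiv:0709.3599 pp. 3, 8–10); LemarieRieusset2016, Thm. 9.12]
-/

noncomputable section

-- the summit and its single sub-problem share the name (CONVENTIONS §1)
set_option linter.dupNamespace false

open scoped Topology InnerProductSpace RealInnerProductSpace ContDiff
open Filter Set Function Metric MeasureTheory
open Literature.Analysis Literature.Analysis.FluidPDE

namespace Summit.NavierStokesRegularity.NavierStokesRegularity.Theorems.PoloidalLiouville.Antidynamo

open Summit.NavierStokesRegularity.NavierStokesRegularity.Theorems.PoloidalLiouville.NetFlux (E3)
open Summit.NavierStokesRegularity.NavierStokesRegularity.Theorems.LocalSineTubeDoorProfileAlignedWindowRigidityAncient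
  (analyticOnNhd_uncurry)

namespace OneInstant

/-! ### §1 Vector algebra in `ℝ³` -/

/-- `⟪a, a⟫ b = ⟪a, b⟫ a − a × (a × b)` (the «BAC − CAB» rule). [folklore] -/
theorem inner_self_smul_eq (a b : E3) : ⟪a, a⟫ • b = ⟪a, b⟫ • a - cross a (cross a b) := by
  ext i
  fin_cases i <;>
    simp [cross, crossProduct, PiLp.inner_apply, Fin.sum_univ_three, EuclideanSpace.norm_sq_eq] <;> ring

/-- If `a ≠ 0` and `a × b = 0`, every vector orthogonal to `a` is orthogonal to `b`. [folklore] -/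
theorem inner_eq_zero_of_cross_eq_zero {a b e : E3} (ha : a ≠ 0) (hab : cross a b = 0) (he : ⟪e, a⟫ = 0) :
    ⟪e, b⟫ = 0 := by
  have h := inner_self_smul_eq a b
  have hc0 : cross a (cross a b) = 0 := by
    rw [hab]
    ext i
    fin_cases i <;> simp [cross, crossProduct]
  rw [hc0, sub_zero] at h
  have h2 := congrArg (fun z : E3 => ⟪e, z⟫) h
  simp only [inner_smul_right, he, mul_zero] at h2
  have haa : ⟪a, a⟫ ≠ 0 := fun h0 => ha (inner_self_eq_zero.1 h0)
  exact (mul_eq_zero.1 h2).resolve_left haa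

/-- A non-zero vector of `ℝ³` has a non-zero orthogonal vector (one of `a × e₀`, `a × e₁`). [folklore] -/
theorem exists_ne_zero_inner_eq_zero {a : E3} (ha : a ≠ 0) : ∃ e : E3, e ≠ 0 ∧ ⟪e, a⟫ = 0 := by
  by_cases h1 : cross a (EuclideanSpace.single 0 (1 : ℝ)) = 0
  · by_cases h2 : cross a (EuclideanSpace.single 1 (1 : ℝ)) = 0
    · exfalso
      apply ha
      have c1 := congrArg (fun z : E3 => z 1) h1
      have c2 := congrArg (fun z : E3 => z 2) h1
      have c0 := congrArg (fun z : E3 => z 2) h2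
      simp [cross, crossProduct] at c0 c1 c2
      ext i
      fin_cases i <;> simp [c0, c1, c2]
    · exact ⟨_, h2, HorizonTower.Zonal.inner_cross_self_left _ _⟩
  · exact ⟨_, h1, HorizonTower.Zonal.inner_cross_self_left _ _⟩

/-- **Reciprocal basis identity**: `⟪a, b × c⟫ x = ⟪x, a⟫ (b × c) + ⟪x, b⟫ (c × a) + ⟪x, c⟫ (a × b)`. [folklore] -/
theorem triple_smul_eq (a b c x : E3) :
    ⟪a, cross b c⟫ • x = ⟪x, a⟫ • cross b c + ⟪x, b⟫ • cross c a + ⟪x, c⟫ • cross a b := by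
  ext i
  fin_cases i <;> simp [cross, crossProduct, PiLp.inner_apply, Fin.sum_univ_three] <;> ring

/-! ### §2 A spanning vorticity triple at every instant -/

/-- **At every instant a non-trivial flow of the wall's class has three vorticity values with non-zero triple product** (else a flat direction at that
instant, excluded by the one-instant Z). [cite: KochNadirashviliSereginSverak2009, Thm 5.2 (arXiv:0709.3599 pp. 9–10)] -/
theorem exists_vorticity_triple
    (v : ℝ → EuclideanSpace ℝ (Fin 3) → EuclideanSpace ℝ (Fin 3)) (x₀ : EuclideanSpace ℝ (Fin 3))
    (hB : Literature.Analysis.FluidPDE.IsBoundedAncientMildSolution 1 v)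
    (hm : ∀ t < 0, AEStronglyMeasurable (v t) volume)
    (hsm : ContDiffOn ℝ (⊤ : ℕ∞) (Function.uncurry v) (Set.Iio 0 ×ˢ Set.univ))
    (hun : ∀ t < 0, ∀ x, ⟪x - x₀, curl (v t) x⟫ = 0)
    (h0 : ¬ ∀ t < 0, ∀ x, curl (v t) x = 0) {t : ℝ} (ht : t < 0) :
    ∃ x₁ x₂ x₃ : EuclideanSpace ℝ (Fin 3), ⟪curl (v t) x₁, cross (curl (v t) x₂) (curl (v t) x₃)⟫ ≠ 0 := by
  by_contra hall
  push Not at hall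
  have hne : ∃ x₁, curl (v t) x₁ ≠ 0 := by
    by_contra h
    push Not at h
    exact h0 (curl_eq_zero_of_curl_slice_eq_zero v x₀ hB hm hsm hun ⟨t, ht, h⟩)
  obtain ⟨x₁, hx₁⟩ := hne
  by_cases hpar : ∀ x₂, cross (curl (v t) x₁) (curl (v t) x₂) = 0
  · obtain ⟨e, he, hea⟩ := exists_ne_zero_inner_eq_zero hx₁
    exact h0 (curl_eq_zero_of_flat_direction_slice v x₀ hB hm hsm hun
      ⟨t, ht, e, he, fun x => inner_eq_zero_of_cross_eq_zero hx₁ (hpar x) hea⟩)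
  · push Not at hpar
    obtain ⟨x₂, hx₂⟩ := hpar
    refine h0 (curl_eq_zero_of_flat_direction_slice v x₀ hB hm hsm hun ⟨t, ht, _, hx₂, fun x => ?_⟩)
    rw [real_inner_comm]
    exact hall x x₁ x₂

/-! ### ★★★ §3 The frame path is real-analytic -/

/-- ★★★ **THE OSEEN GAUGE OF A NON-TRIVIAL FLOW OF THE WALL'S CLASS HAS A REAL-ANALYTIC FRAME PATH.**  Let `v` be a bounded ancient mild solution (`ν = 1`,
duality class) with measurable slices, jointly smooth on `(−∞,0) × ℝ³`, with vorticity tangent to the spheres about `x₀`.  EITHER `curl v ≡ 0`, OR there is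
an Oseen gauge `v(t, x) = w(t, x − A(t)) + c(t)` (`w` continuous, uniformly bounded, weakly divergence-free slices, Oseen integral identity, jointly
real-analytic) whose frame path `A` is REAL-ANALYTIC at every `t < 0` (module docstring for the proof).
[cite: KochNadirashviliSereginSverak2009, §1 p. 3, §4 (i)–(ii) (arXiv:0709.3599 pp. 3, 8); LemarieRieusset2016, Thm. 9.12] -/
theorem curl_eq_zero_or_exists_analytic_gauge
    (v : ℝ → EuclideanSpace ℝ (Fin 3) → EuclideanSpace ℝ (Fin 3)) (x₀ : EuclideanSpace ℝ (Fin 3))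
    (hB : Literature.Analysis.FluidPDE.IsBoundedAncientMildSolution 1 v)
    (hm : ∀ t < 0, AEStronglyMeasurable (v t) volume)
    (hsm : ContDiffOn ℝ (⊤ : ℕ∞) (Function.uncurry v) (Set.Iio 0 ×ˢ Set.univ))
    (hun : ∀ t < 0, ∀ x, ⟪x - x₀, curl (v t) x⟫ = 0) :
    (∀ t < 0, ∀ x, curl (v t) x = 0) ∨
      ∃ (w : ℝ → EuclideanSpace ℝ (Fin 3) → EuclideanSpace ℝ (Fin 3)) (A c : ℝ → EuclideanSpace ℝ (Fin 3)),
        ContinuousOn (Function.uncurry w) (Set.Iio 0 ×ˢ Set.univ) ∧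
        (∃ K : ℝ, ∀ t < 0, ∀ y, ‖w t y‖ ≤ K) ∧
        (∀ t < 0, IsWeaklyDivFree (w t)) ∧
        (∀ s t : ℝ, s < t → t < 0 → ∀ y,
          w t y = UnboundedOperators.heatExtension (w s) (t - s) y - oseenDuhamel 1 s w w t y) ∧
        AnalyticOnNhd ℝ (Function.uncurry w) (Set.Iio (0 : ℝ) ×ˢ (Set.univ : Set (EuclideanSpace ℝ (Fin 3)))) ∧
        (∀ t < 0, ∀ x, v t x = w t (x - A t) + c t) ∧
        ∀ t < 0, AnalyticAt ℝ A t := by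
  by_cases h0 : ∀ t < 0, ∀ x, curl (v t) x = 0
  · exact Or.inl h0
  right
  have hsm' : IsSmoothSpaceTimeOn (Iio 0) v := hsm
  -- ## the Oseen gauge, everywhere
  obtain ⟨w, A, c, -, hwc, ⟨K, hK⟩, hwdiv, hwmild, -, hrep⟩ := Theorems.oseen_gauge_of_aestronglyMeasurable v hB hm
  have hrep' : ∀ s < 0, ∀ y, v s y = w s (y - A s) + c s :=
    fun s hs y => CellFlux.galilean_rep_everywhere hsm.continuousOn hwc hrep hs y
  have hws : ∀ s < 0, w s = fun y => v s (y + A s) - c s := fun s hs => by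
    funext y
    have h := hrep' s hs (y + A s)
    rw [add_sub_cancel_right] at h
    rw [h, add_sub_cancel_right]
  have hw_curl : ∀ s < 0, ∀ y, curl (w s) y = curl (v s) (y + A s) := fun s hs y => by
    rw [hws s hs, CellFlux.curl_comp_add_sub_const]
  have hbdd : ∀ δ : ℝ, 0 < δ → ∃ B : ℝ, ∀ t < -δ, ∀ y : EuclideanSpace ℝ (Fin 3), ‖w t y‖ ≤ B := fun δ hδ =>
    ⟨K, fun t ht y => hK t (by linarith) y⟩
  have hwA : AnalyticOnNhd ℝ (Function.uncurry w) (Set.Iio (0 : ℝ) ×ˢ (Set.univ : Set (EuclideanSpace ℝ (Fin 3)))) :=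
    analyticOnNhd_uncurry hwc hbdd hwmild
  refine ⟨w, A, c, hwc, ⟨K, hK⟩, hwdiv, hwmild, hwA, hrep', fun t₀ ht₀ => ?_⟩
  -- ## analyticity of `s ↦ curl (w s) y` on `(−∞,0)`
  have hω := CellFlux.analyticOnNhd_curl_uncurry hwA
  have hωt : ∀ y : EuclideanSpace ℝ (Fin 3), ∀ s < 0, AnalyticAt ℝ (fun s => curl (w s) y) s := fun y s hs =>
    (hω (s, y) ⟨hs, mem_univ _⟩).comp₂ analyticAt_id analyticAt_const
  -- ## the tangency centre `P s = x₀ − A s` of the representative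
  have htan : ∀ s < 0, ∀ y, ⟪x₀ - A s, curl (w s) y⟫ = ⟪y, curl (w s) y⟫ := fun s hs y => by
    have h := hun s hs (y + A s)
    rw [← hw_curl s hs] at h
    have e : y + A s - x₀ = y - (x₀ - A s) := by abel
    rw [e, inner_sub_left, sub_eq_zero] at h
    exact h.symm
  -- ## a spanning vorticity triple at `t₀`
  obtain ⟨x₁, x₂, x₃, hD⟩ := exists_vorticity_triple v x₀ hB hm hsm hun h0 ht₀
  set y₁ : E3 := x₁ - A t₀
  set y₂ : E3 := x₂ - A t₀
  set y₃ : E3 := x₃ - A t₀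
  set ω₁ : ℝ → E3 := fun s => curl (w s) y₁ with hω₁
  set ω₂ : ℝ → E3 := fun s => curl (w s) y₂ with hω₂
  set ω₃ : ℝ → E3 := fun s => curl (w s) y₃ with hω₃
  have hω₁a : AnalyticAt ℝ ω₁ t₀ := hωt y₁ t₀ ht₀
  have hω₂a : AnalyticAt ℝ ω₂ t₀ := hωt y₂ t₀ ht₀
  have hω₃a : AnalyticAt ℝ ω₃ t₀ := hωt y₃ t₀ ht₀
  set D : ℝ → ℝ := fun s => ⟪ω₁ s, cross (ω₂ s) (ω₃ s)⟫ with hDdef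
  have hDa : AnalyticAt ℝ D t₀ := CellFlux.analyticAt_inner hω₁a (CellFlux.analyticAt_cross hω₂a hω₃a)
  have hD₀ : D t₀ ≠ 0 := by
    simp only [hDdef, hω₁, hω₂, hω₃, hw_curl t₀ ht₀]
    simpa [y₁, y₂, y₃] using hD
  -- ## the explicit formula for the centre near `t₀`
  set N : ℝ → E3 := fun s => ⟪y₁, ω₁ s⟫ • cross (ω₂ s) (ω₃ s) + ⟪y₂, ω₂ s⟫ • cross (ω₃ s) (ω₁ s) +
    ⟪y₃, ω₃ s⟫ • cross (ω₁ s) (ω₂ s) with hNdef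
  have hNa : AnalyticAt ℝ N t₀ := by
    have h1 := (CellFlux.analyticAt_inner (analyticAt_const (v := y₁)) hω₁a).smul (CellFlux.analyticAt_cross hω₂a hω₃a)
    have h2 := (CellFlux.analyticAt_inner (analyticAt_const (v := y₂)) hω₂a).smul (CellFlux.analyticAt_cross hω₃a hω₁a)
    have h3 := (CellFlux.analyticAt_inner (analyticAt_const (v := y₃)) hω₃a).smul (CellFlux.analyticAt_cross hω₁a hω₂a)
    exact (h1.add h2).add h3
  have hkey : ∀ s < 0, D s • (x₀ - A s) = N s := fun s hs => by
    simp only [hDdef, hNdef]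
    rw [triple_smul_eq, htan s hs y₁, htan s hs y₂, htan s hs y₃]
  have hF : AnalyticAt ℝ (fun s => (D s)⁻¹ • N s) t₀ := (hDa.inv hD₀).smul hNa
  -- ## `A = x₀ − D⁻¹ N` near `t₀`
  have hev : (fun s => x₀ - (D s)⁻¹ • N s) =ᶠ[𝓝 t₀] A := by
    have h1 : ∀ᶠ s in 𝓝 t₀, D s ≠ 0 := hDa.continuousAt.eventually_ne hD₀
    have h2 : ∀ᶠ s in 𝓝 t₀, s < 0 := Iio_mem_nhds ht₀
    filter_upwards [h1, h2] with s hs1 hs2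
    rw [← hkey s hs2, inv_smul_smul₀ hs1]
    abel
  exact (analyticAt_const.sub hF).congr hev

/-! ### ★★ (ML-a): the wall from the mild moving-centre statement with an ANALYTIC centre -/

/-- ★★ **THE WALL'S VORTICITY CONCLUSION FROM (ML-a)** — as `curl_eq_zero_of_mild_movingCentre` (p819292), but the hypothesis may in addition assume that
the moving centre `p` is REAL-ANALYTIC on `(−∞,0)`. [cite: KochNadirashviliSereginSverak2009, §1 p. 3, §4 (i)–(ii) (arXiv:0709.3599 pp. 3, 8); LemarieRieusset2016, Thm. 9.12] -/
theorem curl_eq_zero_of_mild_analyticCentre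
    (hML : ∀ (w : ℝ → EuclideanSpace ℝ (Fin 3) → EuclideanSpace ℝ (Fin 3)) (p : ℝ → EuclideanSpace ℝ (Fin 3)),
      ContinuousOn (Function.uncurry w) (Set.Iio 0 ×ˢ Set.univ) →
      (∃ K : ℝ, ∀ t < 0, ∀ y, ‖w t y‖ ≤ K) →
      (∀ t < 0, IsWeaklyDivFree (w t)) →
      (∀ s t : ℝ, s < t → t < 0 → ∀ y,
        w t y = UnboundedOperators.heatExtension (w s) (t - s) y - oseenDuhamel 1 s w w t y) →
      AnalyticOnNhd ℝ (Function.uncurry w) (Set.Iio (0 : ℝ) ×ˢ (Set.univ : Set (EuclideanSpace ℝ (Fin 3)))) →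
      (∀ t < 0, ContDiff ℝ (⊤ : ℕ∞) (w t)) →
      (∀ t < 0, AnalyticAt ℝ p t) →
      (∀ t < 0, ∀ y, ⟪y - p t, curl (w t) y⟫ = 0) →
      ∀ t < 0, ∀ y, curl (w t) y = 0)
    (v : ℝ → EuclideanSpace ℝ (Fin 3) → EuclideanSpace ℝ (Fin 3)) (x₀ : EuclideanSpace ℝ (Fin 3))
    (hB : Literature.Analysis.FluidPDE.IsBoundedAncientMildSolution 1 v)
    (hm : ∀ t < 0, AEStronglyMeasurable (v t) volume)
    (hsm : ContDiffOn ℝ (⊤ : ℕ∞) (Function.uncurry v) (Set.Iio 0 ×ˢ Set.univ))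
    (hun : ∀ t < 0, ∀ x, ⟪x - x₀, curl (v t) x⟫ = 0) :
    ∀ t < 0, ∀ x, curl (v t) x = 0 := by
  rcases curl_eq_zero_or_exists_analytic_gauge v x₀ hB hm hsm hun with h0 | ⟨w, A, c, hwc, hwb, hwdiv, hwmild, hwA, hrep', hA⟩
  · exact h0
  have hsm' : IsSmoothSpaceTimeOn (Iio 0) v := hsm
  have hws : ∀ s < 0, w s = fun y => v s (y + A s) - c s := fun s hs => by
    funext y
    have h := hrep' s hs (y + A s)
    rw [add_sub_cancel_right] at h
    rw [h, add_sub_cancel_right]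
  have hw_smooth : ∀ s < 0, ContDiff ℝ (⊤ : ℕ∞) (w s) := fun s hs => by
    rw [hws s hs]
    exact ((hsm'.contDiff_slice hs).comp (contDiff_id.add contDiff_const)).sub contDiff_const
  have hw_curl : ∀ s < 0, ∀ y, curl (w s) y = curl (v s) (y + A s) := fun s hs y => by
    rw [hws s hs, CellFlux.curl_comp_add_sub_const]
  have htan : ∀ t < 0, ∀ y, ⟪y - (x₀ - A t), curl (w t) y⟫ = 0 := fun t ht y => by
    rw [hw_curl t ht]
    have h := hun t ht (y + A t)
    have e : y + A t - x₀ = y - (x₀ - A t) := by abel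
    rwa [e] at h
  have hpA : ∀ t < 0, AnalyticAt ℝ (fun t => x₀ - A t) t := fun t ht => analyticAt_const.sub (hA t ht)
  have hw0 := hML w (fun t => x₀ - A t) hwc hwb hwdiv hwmild hwA hw_smooth hpA htan
  intro t ht x
  have h := hw0 t ht (x - A t)
  rwa [hw_curl t ht, sub_add_cancel] at h

/-- ★★ **THE WALL FROM (ML-a), BY NAME.** [cite: KochNadirashviliSereginSverak2009, §1 p. 3, §4 (i)–(ii), Thm 5.2 (arXiv:0709.3599 pp. 3, 8–10)] -/
theorem stubScalarLiouville_of_mild_analyticCentre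
    (hML : ∀ (w : ℝ → EuclideanSpace ℝ (Fin 3) → EuclideanSpace ℝ (Fin 3)) (p : ℝ → EuclideanSpace ℝ (Fin 3)),
      ContinuousOn (Function.uncurry w) (Set.Iio 0 ×ˢ Set.univ) →
      (∃ K : ℝ, ∀ t < 0, ∀ y, ‖w t y‖ ≤ K) →
      (∀ t < 0, IsWeaklyDivFree (w t)) →
      (∀ s t : ℝ, s < t → t < 0 → ∀ y,
        w t y = UnboundedOperators.heatExtension (w s) (t - s) y - oseenDuhamel 1 s w w t y) →
      AnalyticOnNhd ℝ (Function.uncurry w) (Set.Iio (0 : ℝ) ×ˢ (Set.univ : Set (EuclideanSpace ℝ (Fin 3)))) →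
      (∀ t < 0, ContDiff ℝ (⊤ : ℕ∞) (w t)) →
      (∀ t < 0, AnalyticAt ℝ p t) →
      (∀ t < 0, ∀ y, ⟪y - p t, curl (w t) y⟫ = 0) →
      ∀ t < 0, ∀ y, curl (w t) y = 0) :
    StubScalarLiouville := by
  intro v x₀ T hB hm hsm _hT _hTb hrep _hE
  have hun : ∀ t < 0, ∀ x, ⟪x - x₀, curl (v t) x⟫ = 0 := fun t ht x => by
    rw [hrep t ht x]
    simp [cross, crossProduct, PiLp.inner_apply, Fin.sum_univ_three]
    ring
  intro t ht x
  rw [← hrep t ht x]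
  exact curl_eq_zero_of_mild_analyticCentre hML v x₀ hB hm hsm hun t ht x

/-- ★★ **… AND THE CRUX FROM (ML-a)** (route `UnthreadedDoor` decl; composition p793469 by name). -/
theorem poloidalLiouville_of_mild_analyticCentre
    (hML : ∀ (w : ℝ → EuclideanSpace ℝ (Fin 3) → EuclideanSpace ℝ (Fin 3)) (p : ℝ → EuclideanSpace ℝ (Fin 3)),
      ContinuousOn (Function.uncurry w) (Set.Iio 0 ×ˢ Set.univ) →
      (∃ K : ℝ, ∀ t < 0, ∀ y, ‖w t y‖ ≤ K) →
      (∀ t < 0, IsWeaklyDivFree (w t)) →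
      (∀ s t : ℝ, s < t → t < 0 → ∀ y,
        w t y = UnboundedOperators.heatExtension (w s) (t - s) y - oseenDuhamel 1 s w w t y) →
      AnalyticOnNhd ℝ (Function.uncurry w) (Set.Iio (0 : ℝ) ×ˢ (Set.univ : Set (EuclideanSpace ℝ (Fin 3)))) →
      (∀ t < 0, ContDiff ℝ (⊤ : ℕ∞) (w t)) →
      (∀ t < 0, AnalyticAt ℝ p t) →
      (∀ t < 0, ∀ y, ⟪y - p t, curl (w t) y⟫ = 0) →
      ∀ t < 0, ∀ y, curl (w t) y = 0) :
    Summit.NavierStokesRegularity.NavierStokesRegularity.Theses.UnthreadedDoor.PoloidalLiouville :=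
  poloidalLiouville_of_stubScalarLiouville' (stubScalarLiouville_of_mild_analyticCentre hML)

end OneInstant

end Summit.NavierStokesRegularity.NavierStokesRegularity.Theorems.PoloidalLiouville.Antidynamo

end
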